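import Literature.Probability.FitznerVanDerHofstad2017.SrwOriginTailKernel
import Literature.Probability.FitznerVanDerHofstad2017.SawExactAtomRegistry
import HarnessLib

/-!
# The `WBX(M)` cell with the EXACT-ATOM OVERLAY (kernel-generic in `d`)

`WbxCellKernel` evaluates the list-indexed `WBX(M)` cell of `LiveEndpointClasses`
(`toReal_tsum_sq_weighted_repBubble_le_liveListAtomsCanon`) with EVERY walk-count atom read by the
non-backtracking majorant `b_n(x) ≥ c_n(x)` (`nbwAtomFast`): cheap and valid at every order, but it gives away the
difference `b_n(x) − c_n(x)` at the low orders where the exact self-avoiding counts `c_n(x)` ARE certified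
(`SawCountTables*`, collected in `SawExactAtomRegistry`: every class with `n ≤ 9`, `74/82` classes at `n = 10`,
near-axis classes at `11 ≤ n ≤ 14`).  This module is the same evaluator with the overlay
`a_n(x) := c_n(x)` where the registry certifies it, `:= b_n(x)` elsewhere (`sawAtomX`), for the OUTER atom `c_i(x)`
and for every INNER atom `c_r(x)`, `r < L`, of each live class — and the theorem that it, too, is the right-hand
side of the cell.  The inner sum keeps the one-row weight identity of `WbxCellKernel.nbwInnerQ` and adds a sparse
correction `Σ_{r<L, certified} z^r (c_r − b_r) ≤ 0` (`sawInnerCorrQ`), so the kernel cost per class is that of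
`WbxCellKernel` plus at most `L` registry look-ups (empty buckets for `r ≥ 15`).

* §1 `sawAtomX d L l r` (exact-or-majorant atom at the canonical class point), its soundness
  `c_r(canonSite d l) ≤ sawAtomX ≤ nbwAtomFast`.
* §2 `wbxClassXQ`, `wbxClassesXQ` / `wbxOrderXQ` (+ chunking), the cut-policy forms `wbxClassesPolicyXQ` /
  `wbxOrderPolicyXQ`.
* §3 The evaluator is the right-hand side of the cell: `toReal_tsum_sq_weighted_repBubble_le_sum_wbxOrderXQ`,
  `…_le_orderXBounds`, `…_le_sum_wbxOrderPolicyXQ`, `…_le_policyXBounds` (+ the `…_of_farValues` forms whose far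
  values are any rational majorants of `K_{1,2J}(x_l)`, the hook for `W`-split values) — binders literally those of the
  `WbxCellKernel` theorems (so the origin-column lemmas of `SrwOriginTailKernel` / the `I`-tables discharge `hI`
  unchanged); the overlay never exceeds the all-NBW evaluator (`wbxOrderXQ_le_wbxOrderQ`); and the two one-stop
  forms with an origin `I`-table of extent `Λ` as the ONLY far-node input (`…_le_orderXBounds_of_originTable`,
  `…_le_policyXBounds_of_originTable`, the far rationals being `SrwOriginTailKernel.srwIZeroExtQ d Λ T (2J)`).
* §4 Sanity evaluations (toy data; `decide +kernel`).

Pointer language: an input-certification form — every theorem is generic in `d ≥ 3` with the diagrammatic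
constants, `z ≥ p` and the far-node data as hypotheses; nothing is asserted about any particular dimension.

References: R. Fitzner, R. van der Hofstad, *Generalized approach to the non-backtracking lace expansion*,
PTRF 169 (2017) [NoBLE], §5.3.1 (5.36)–(5.38), §5.3.3 p. 1098 (the explicit terms with exact `c_i(x)` class by
class, the NBW majorant beyond the tables), (5.14) p. 1092, (5.26) p. 1094; *Mean-field behavior for
nearest-neighbor percolation in `d > 10`*, EJP 22 (2017), §4.2 (4.18); N. Madras, G. Slade, *The Self-Avoiding
Walk* (1993), §1.2 and Cor. 5.3.2.
-/

namespace Literature.Probability.FitznerVanDerHofstad2017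

open _root_.MeasureTheory Finset
open Literature.Barriers.CriticalPhenomena Literature.Probability.Percolation
open Literature.Probability.LatticeModels
open SrwCount (sum_map_range getD_map_range srwCount)
open scoped BigOperators ENNReal

variable {d : ℕ}

/-! ### §1. The exact-or-majorant atom -/

/-- **The overlay atom** at the canonical point of the class `l`: the certified exact count
`c_r(canonSite d l)` when `(r, coordList 1 l)` is in the registry, the fast NBW majorant `b_r(canonSite d l)`
(row of cut `L`, valid for `r ≤ L`) otherwise.
[cite: FitznerVanDerHofstad2016NoBLE, §5.3.3 p. 1098 (exact `c_i(x)` class by class, NBW beyond the tables)]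
[cite: FitznerVanDerHofstad2017, §4.2 (4.18)] -/
def sawAtomX (d L : ℕ) (l : List ℕ) (r : ℕ) : ℤ :=
  match sawExactAtom? d r (coordList 1 l) with
  | some v => (v : ℤ)
  | none => nbwAtomFast d L l r

/-- **Soundness of the overlay atom**: `c_r(canonSite d l) ≤ sawAtomX d L l r` for `r ≤ L`, `Σ l ≤ d`
(equality on a registry hit, `c_r ≤ b_r` on a miss). [cite: FitznerVanDerHofstad2017, §4.2 (4.18)]
[cite: MadrasSlade1993, §1.2 (c_N ≤ c_{N,2})] -/
theorem cast_card_sawWordsTo_canonSite_le_sawAtomX {L r : ℕ} {l : List ℕ} (hl : l.sum ≤ d) (hr : r ≤ L) :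
    ((sawWordsTo d r (canonSite d l)).card : ℝ) ≤ (sawAtomX d L l r : ℝ) := by
  unfold sawAtomX
  cases h : sawExactAtom? d r (coordList 1 l) with
  | some v => simp [card_sawWordsTo_canonSite_of_sawExactAtom? hl h]
  | none => simpa [nbwAtomFast_eq_nbwAtom hl hr hr] using cast_card_sawWordsTo_canonSite_le_nbwAtom (L := L) l hr

/-- `0 ≤ sawAtomX d L l r` for `r ≤ L`, `Σ l ≤ d`. [cite: FitznerVanDerHofstad2017, §4.2 (4.18)] -/
theorem sawAtomX_nonneg {L r : ℕ} {l : List ℕ} (hl : l.sum ≤ d) (hr : r ≤ L) : (0 : ℝ) ≤ (sawAtomX d L l r : ℝ) :=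
  le_trans (by positivity) (cast_card_sawWordsTo_canonSite_le_sawAtomX hl hr)

/-- A registry hit is below the NBW majorant: `sawExactAtom? d r (coordList 1 l) = some v → v ≤ b_r(canonSite d l)`
(`r ≤ L`, `Σ l ≤ d`). [cite: MadrasSlade1993, §1.2 (c_N ≤ c_{N,2})] -/
theorem le_nbwAtomFast_of_sawExactAtom? {L r v : ℕ} {l : List ℕ} (hl : l.sum ≤ d) (hr : r ≤ L)
    (h : sawExactAtom? d r (coordList 1 l) = some v) : (v : ℤ) ≤ nbwAtomFast d L l r := by
  rw [← card_sawWordsTo_canonSite_of_sawExactAtom? hl h, nbwAtomFast_eq_card hl hr]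
  exact_mod_cast card_sawWordsTo_le_card_nbwWordsTo r (canonSite d l)

/-- **The overlay never loses**: `sawAtomX d L l r ≤ nbwAtomFast d L l r` (`r ≤ L`, `Σ l ≤ d`).
[cite: MadrasSlade1993, §1.2 (c_N ≤ c_{N,2})] -/
theorem sawAtomX_le_nbwAtomFast {L r : ℕ} {l : List ℕ} (hl : l.sum ≤ d) (hr : r ≤ L) :
    sawAtomX d L l r ≤ nbwAtomFast d L l r := by
  unfold sawAtomX
  cases h : sawExactAtom? d r (coordList 1 l) with
  | some v => simpa using le_nbwAtomFast_of_sawExactAtom? hl hr h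
  | none => simp

/-- `0 ≤ sawAtomX d L l r` over `ℤ` (`r ≤ L`, `Σ l ≤ d`). [cite: FitznerVanDerHofstad2017, §4.2 (4.18)] -/
theorem sawAtomX_nonneg_int {L r : ℕ} {l : List ℕ} (hl : l.sum ≤ d) (hr : r ≤ L) : 0 ≤ sawAtomX d L l r := by
  unfold sawAtomX
  cases sawExactAtom? d r (coordList 1 l) with
  | some v => simp
  | none => simpa using nbwAtomFast_nonneg hl hr

/-! ### §2. The overlay evaluators -/

/-- **The sparse inner correction** `Σ_{r<L, (r,l) certified} z^r · (c_r − b_r)(canonSite d l)` (non-positive for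
`z ≥ 0`; empty for classes far from the axes and for `r ≥ 15`). [cite: FitznerVanDerHofstad2016NoBLE, §5.3.3 p. 1098] -/
def sawInnerCorrQ (d L : ℕ) (l : List ℕ) (z : ℚ) : ℚ :=
  ((List.range L).map fun r =>
    match sawExactAtom? d r (coordList 1 l) with
    | some v => z ^ r * ((v : ℚ) - (nbwAtomFast d L l r : ℚ))
    | none => 0).sum

/-- **One live class with the overlay** (`l` of order `i`, constant cut `L ≥ i`, rational data):
`#class(l) · a_i · (‖·‖₂² · (Σ_{r<L} z^r a_r + (2dz)^L · ρ_d g₁ · I))`, `a = sawAtomX`, the inner sum computed as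
`nbwInnerQ` (one fast row, weight identity) plus `sawInnerCorrQ`.
[cite: FitznerVanDerHofstad2016NoBLE, §5.3.3 p. 1098; §5.3.1 (5.36)–(5.38)]
[cite: FitznerVanDerHofstad2017, §4.2 (4.18)] -/
def wbxClassXQ (d i L : ℕ) (l : List ℕ) (z g₁ I : ℚ) : ℚ :=
  ((2 ^ l.sum * d.descFactorial l.sum / (l.map Nat.factorial).prod : ℕ) : ℚ) *
    ((sawAtomX d L l i : ℚ) * ((sqwsum 1 l : ℚ) *
      (nbwInnerQ d L z (srwCountRowFast d L (canonMagnitudes l)) + sawInnerCorrQ d L l z +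
        (2 * d * z) ^ L * ((2 * d - 2) / (2 * d - 1) * g₁) * I)))

/-- A chunk of classes with the overlay. [cite: FitznerVanDerHofstad2016NoBLE, §5.3.3 p. 1098] -/
def wbxClassesXQ (d i L : ℕ) (z g₁ I : ℚ) (ls : List (List ℕ)) : ℚ :=
  (ls.map fun l => wbxClassXQ d i L l z g₁ I).sum

/-- **One order with the overlay**: `Σ_{l ∈ liveList d i} wbxClassXQ`. [cite: FitznerVanDerHofstad2016NoBLE, §5.3.3 p. 1098] -/
def wbxOrderXQ (d i L : ℕ) (z g₁ I : ℚ) : ℚ := wbxClassesXQ d i L z g₁ I (liveList d i)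

/-- Chunking: `wbxClassesXQ` splits at any position of the class list. [cite: FitznerVanDerHofstad2016NoBLE, §5.3.3 p. 1098] -/
theorem wbxClassesXQ_eq_take_add_drop (d i L : ℕ) (z g₁ I : ℚ) (ls : List (List ℕ)) (n : ℕ) :
    wbxClassesXQ d i L z g₁ I ls = wbxClassesXQ d i L z g₁ I (ls.take n) + wbxClassesXQ d i L z g₁ I (ls.drop n) := by
  rw [wbxClassesXQ, wbxClassesXQ, wbxClassesXQ, ← List.sum_append, ← List.map_append, List.take_append_drop]

/-- Chunking an order at position `n` of its live list. [cite: FitznerVanDerHofstad2016NoBLE, §5.3.3 p. 1098] -/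
theorem wbxOrderXQ_eq_take_add_drop (d i L : ℕ) (z g₁ I : ℚ) (n : ℕ) :
    wbxOrderXQ d i L z g₁ I =
      wbxClassesXQ d i L z g₁ I ((liveList d i).take n) + wbxClassesXQ d i L z g₁ I ((liveList d i).drop n) :=
  wbxClassesXQ_eq_take_add_drop d i L z g₁ I (liveList d i) n

/-- Strict application of a cut-indexed quantity (the kernel reduces the cut to a numeral first, so a cut given
by a function of the class is shared like a literal; cf. `WbxCellKernel`). [folklore] -/
private def strictAppXQ (f : ℕ → ℚ) (n : ℕ) : ℚ := Nat.rec (motive := fun _ => ℚ) (f 0) (fun m _ => f (m + 1)) n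

/-- `strictAppXQ f n = f n`. [folklore] -/
private theorem strictAppXQ_eq (f : ℕ → ℚ) (n : ℕ) : strictAppXQ f n = f n := by
  cases n <;> rfl

/-- A chunk of classes of order `i` with the overlay under a per-class CUT POLICY `J` (even cuts `2·J l`) and
per-class far-node rationals `I l`. [cite: FitznerVanDerHofstad2016NoBLE, §5.3.3 p. 1098; (5.14) p. 1092, (5.26) p. 1094] -/
def wbxClassesPolicyXQ (d i : ℕ) (J : List ℕ → ℕ) (z g₁ : ℚ) (I : List ℕ → ℚ) (ls : List (List ℕ)) : ℚ :=
  (ls.map fun l => strictAppXQ (fun L => wbxClassXQ d i L l z g₁ (I l)) (2 * J l)).sum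

/-- **One order with the overlay under a cut policy.**
[cite: FitznerVanDerHofstad2016NoBLE, §5.3.3 p. 1098; (5.14) p. 1092, (5.26) p. 1094] -/
def wbxOrderPolicyXQ (d i : ℕ) (J : List ℕ → ℕ) (z g₁ : ℚ) (I : List ℕ → ℚ) : ℚ :=
  wbxClassesPolicyXQ d i J z g₁ I (liveList d i)

/-- Chunking under a policy. [cite: FitznerVanDerHofstad2016NoBLE, §5.3.3 p. 1098] -/
theorem wbxClassesPolicyXQ_eq_take_add_drop (d i : ℕ) (J : List ℕ → ℕ) (z g₁ : ℚ) (I : List ℕ → ℚ)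
    (ls : List (List ℕ)) (n : ℕ) :
    wbxClassesPolicyXQ d i J z g₁ I ls =
      wbxClassesPolicyXQ d i J z g₁ I (ls.take n) + wbxClassesPolicyXQ d i J z g₁ I (ls.drop n) := by
  rw [wbxClassesPolicyXQ, wbxClassesPolicyXQ, wbxClassesPolicyXQ, ← List.sum_append, ← List.map_append,
    List.take_append_drop]

/-- Chunking an order under a policy. [cite: FitznerVanDerHofstad2016NoBLE, §5.3.3 p. 1098] -/
theorem wbxOrderPolicyXQ_eq_take_add_drop (d i : ℕ) (J : List ℕ → ℕ) (z g₁ : ℚ) (I : List ℕ → ℚ) (n : ℕ) :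
    wbxOrderPolicyXQ d i J z g₁ I = wbxClassesPolicyXQ d i J z g₁ I ((liveList d i).take n) +
      wbxClassesPolicyXQ d i J z g₁ I ((liveList d i).drop n) :=
  wbxClassesPolicyXQ_eq_take_add_drop d i J z g₁ I (liveList d i) n

/-! ### §3. The overlay evaluator is the right-hand side of the cell -/

/-- The inner sum with the correction IS `Σ_{r<L} z^r a_r` (`a = sawAtomX`), for `Σ l ≤ d`.
[cite: MadrasSlade1993, Cor. 5.3.2 (5.3.3) (reprint PDF p. 148)] -/
theorem nbwInnerQ_add_sawInnerCorrQ {L : ℕ} {l : List ℕ} (hl : l.sum ≤ d) (z : ℚ) :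
    nbwInnerQ d L z (srwCountRowFast d L (canonMagnitudes l)) + sawInnerCorrQ d L l z =
      ∑ r ∈ range L, z ^ r * (sawAtomX d L l r : ℚ) := by
  rw [nbwInnerQ_srwCountRowFast hl, sawInnerCorrQ, sum_map_range, ← sum_add_distrib]
  refine sum_congr rfl fun r _ => ?_
  unfold sawAtomX
  cases sawExactAtom? d r (coordList 1 l) with
  | none => simp
  | some v => push_cast; ring

/-- The sparse correction is non-positive for `z ≥ 0` (`Σ l ≤ d`). [cite: MadrasSlade1993, §1.2 (c_N ≤ c_{N,2})] -/
theorem sawInnerCorrQ_nonpos {L : ℕ} {l : List ℕ} (hl : l.sum ≤ d) {z : ℚ} (hz : 0 ≤ z) :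
    sawInnerCorrQ d L l z ≤ 0 := by
  rw [sawInnerCorrQ, sum_map_range]
  refine sum_nonpos fun r hr => ?_
  cases h : sawExactAtom? d r (coordList 1 l) with
  | none => simp
  | some v =>
    have hv : (v : ℚ) ≤ (nbwAtomFast d L l r : ℚ) := by
      exact_mod_cast le_nbwAtomFast_of_sawExactAtom? hl (mem_range.1 hr).le h
    simpa using mul_nonpos_of_nonneg_of_nonpos (pow_nonneg hz r) (sub_nonpos.2 hv)

/-- **The overlay class term never exceeds the all-NBW class term** of `WbxCellKernel` (live class, `i ≤ L`,
`z, g₁, I ≥ 0`): any kernel certificate `wbxOrderQ … ≤ q` remains one for `wbxOrderXQ`.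
[cite: MadrasSlade1993, §1.2 (c_N ≤ c_{N,2})]
[cite: FitznerVanDerHofstad2016NoBLE, §5.3.3 p. 1098] -/
theorem wbxClassXQ_le_wbxClassQ {i L : ℕ} {l : List ℕ} (hl : l ∈ liveList d i) (hi : i ≤ L) {z g₁ I : ℚ}
    (hz : 0 ≤ z) (hg : 0 ≤ g₁) (hI : 0 ≤ I) : wbxClassXQ d i L l z g₁ I ≤ wbxClassQ d i L l z g₁ I := by
  have hsum : l.sum ≤ d := (mem_liveList.1 hl).2.2.1
  have hN : 0 ≤ nbwInnerQ d L z (srwCountRowFast d L (canonMagnitudes l)) := by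
    rw [nbwInnerQ_srwCountRowFast hsum]
    exact sum_nonneg fun r hr => mul_nonneg (pow_nonneg hz r)
      (by exact_mod_cast nbwAtomFast_nonneg hsum (mem_range.1 hr).le)
  have hρ : (0 : ℚ) ≤ (2 * d - 2) / (2 * d - 1) := by
    rcases Nat.eq_zero_or_pos d with rfl | hd
    · norm_num
    · have h1 : (1 : ℚ) ≤ d := by exact_mod_cast hd
      exact div_nonneg (by linarith) (by linarith)
  have hF : 0 ≤ (2 * d * z) ^ L * ((2 * d - 2) / (2 * d - 1) * g₁) * I :=
    mul_nonneg (mul_nonneg (pow_nonneg (by positivity) L) (mul_nonneg hρ hg)) hI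
  have hc : sawInnerCorrQ d L l z ≤ 0 := sawInnerCorrQ_nonpos hsum hz
  have ha : (sawAtomX d L l i : ℚ) ≤ (nbwAtomFast d L l i : ℚ) := by
    exact_mod_cast sawAtomX_le_nbwAtomFast hsum hi
  have ha0 : (0 : ℚ) ≤ (sawAtomX d L l i : ℚ) := by exact_mod_cast sawAtomX_nonneg_int hsum hi
  have hs : (0 : ℚ) ≤ (sqwsum 1 l : ℚ) := by positivity
  have hA : (0 : ℚ) ≤ ((2 ^ l.sum * d.descFactorial l.sum / (l.map Nat.factorial).prod : ℕ) : ℚ) := by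
    positivity
  unfold wbxClassXQ wbxClassQ
  set N := nbwInnerQ d L z (srwCountRowFast d L (canonMagnitudes l))
  set F := (2 * d * z) ^ L * ((2 * d - 2) / (2 * d - 1) * g₁) * I
  have hT : 0 ≤ (sqwsum 1 l : ℚ) * (N + F) := mul_nonneg hs (add_nonneg hN hF)
  exact mul_le_mul_of_nonneg_left
    ((mul_le_mul_of_nonneg_left (mul_le_mul_of_nonneg_left (by linarith) hs) ha0).trans
      (mul_le_mul_of_nonneg_right ha hT)) hA

/-- The overlay order evaluator never exceeds the all-NBW one (`i ≤ L`, `z, g₁, I ≥ 0`); likewise chunk by chunk.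
[cite: MadrasSlade1993, §1.2 (c_N ≤ c_{N,2})] -/
theorem wbxClassesXQ_le_wbxClassesQ {i L : ℕ} (hi : i ≤ L) {z g₁ I : ℚ} (hz : 0 ≤ z) (hg : 0 ≤ g₁) (hI : 0 ≤ I)
    {ls : List (List ℕ)} (hls : ∀ l ∈ ls, l ∈ liveList d i) :
    wbxClassesXQ d i L z g₁ I ls ≤ wbxClassesQ d i L z g₁ I ls := by
  unfold wbxClassesXQ wbxClassesQ
  exact List.sum_le_sum fun l hl => wbxClassXQ_le_wbxClassQ (hls l hl) hi hz hg hI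

/-- `wbxOrderXQ d i L z g₁ I ≤ wbxOrderQ d i L z g₁ I` (`i ≤ L`, `z, g₁, I ≥ 0`).
[cite: MadrasSlade1993, §1.2 (c_N ≤ c_{N,2})] -/
theorem wbxOrderXQ_le_wbxOrderQ {i L : ℕ} (hi : i ≤ L) {z g₁ I : ℚ} (hz : 0 ≤ z) (hg : 0 ≤ g₁) (hI : 0 ≤ I) :
    wbxOrderXQ d i L z g₁ I ≤ wbxOrderQ d i L z g₁ I :=
  wbxClassesXQ_le_wbxClassesQ hi hz hg hI fun _ hl => hl

/-- Cast of one overlay class term to the shape of `toReal_tsum_sq_weighted_repBubble_le_liveListAtomsCanon`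
(`C i l := a_i`, `b i l r := a_r`), for a live class. [folklore] -/
private theorem cast_wbxClassXQ {i L : ℕ} {l : List ℕ} (hl : l ∈ liveList d i) (z g₁ I : ℚ) :
    ((wbxClassXQ d i L l z g₁ I : ℚ) : ℝ) =
      ((2 ^ l.sum * d.descFactorial l.sum / (l.map Nat.factorial).prod : ℕ) : ℝ) *
        ((sawAtomX d L l i : ℝ) * ((sqwsum 1 l : ℝ) *
          ((∑ r ∈ range L, (z : ℝ) ^ r * (sawAtomX d L l r : ℝ)) +
            (2 * d * (z : ℝ)) ^ L * ((2 * d - 2) / (2 * d - 1) * (g₁ : ℝ)) * (I : ℝ)))) := by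
  have hsum : l.sum ≤ d := (mem_liveList.1 hl).2.2.1
  rw [wbxClassXQ, nbwInnerQ_add_sawInnerCorrQ hsum]
  push_cast
  rfl

/-- Cast of one overlay order. [folklore] -/
private theorem cast_wbxOrderXQ (i L : ℕ) (z g₁ I : ℚ) :
    ((wbxOrderXQ d i L z g₁ I : ℚ) : ℝ) =
      ((liveList d i).map fun l =>
        ((2 ^ l.sum * d.descFactorial l.sum / (l.map Nat.factorial).prod : ℕ) : ℝ) *
          ((sawAtomX d L l i : ℝ) * ((sqwsum 1 l : ℝ) *
            ((∑ r ∈ range L, (z : ℝ) ^ r * (sawAtomX d L l r : ℝ)) +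
              (2 * d * (z : ℝ)) ^ L * ((2 * d - 2) / (2 * d - 1) * (g₁ : ℝ)) * (I : ℝ))))).sum := by
  rw [wbxOrderXQ, wbxClassesXQ, Rat.cast_list_sum, List.map_map]
  exact congrArg List.sum (List.map_congr_left fun l hl => cast_wbxClassXQ hl z g₁ I)

/-- Cast of one overlay order under a cut policy. [folklore] -/
private theorem cast_wbxOrderPolicyXQ (i : ℕ) (J : List ℕ → ℕ) (z g₁ : ℚ) (I : List ℕ → ℚ) :
    ((wbxOrderPolicyXQ d i J z g₁ I : ℚ) : ℝ) =
      ((liveList d i).map fun l =>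
        ((2 ^ l.sum * d.descFactorial l.sum / (l.map Nat.factorial).prod : ℕ) : ℝ) *
          ((sawAtomX d (2 * J l) l i : ℝ) * ((sqwsum 1 l : ℝ) *
            ((∑ r ∈ range (2 * J l), (z : ℝ) ^ r * (sawAtomX d (2 * J l) l r : ℝ)) +
              (2 * d * (z : ℝ)) ^ (2 * J l) * ((2 * d - 2) / (2 * d - 1) * (g₁ : ℝ)) * (I l : ℝ))))).sum := by
  rw [wbxOrderPolicyXQ, wbxClassesPolicyXQ, Rat.cast_list_sum, List.map_map]
  exact congrArg List.sum (List.map_congr_left fun l hl => by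
    rw [Function.comp_apply, strictAppXQ_eq, cast_wbxClassXQ hl])

/-- **The `WBX(M)` cell at the OVERLAY reading, order by order, with a cut per order**: for rational `z ≥ p`,
rational majorants `γ` of the diagrammatic constants, even cuts `2·J i ≥ i` and rationals `I i ≥ I_{1,2J_i}(0; d)`,
`Σ'_y ‖y‖₂² P_p(0 ⟷_{≥m} y ∘ y ⟷ 0) ≤ Σ_{i=m}^{M} z^i · wbxOrderXQ d i (2J_i) z γ₁ I_i + (2dz)^{M+1} γ₂ c_k`
— the binders of `WbxCellKernel.toReal_tsum_sq_weighted_repBubble_le_sum_wbxOrderQ`, verbatim.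
Pointer language: an input-certification form, no statement about any dimension.
[cite: FitznerVanDerHofstad2016NoBLE, §5.3.1 (5.36)–(5.38) with §5.3.3 p. 1098; (5.14) p. 1092, (5.26) p. 1094]
[cite: FitznerVanDerHofstad2017, §4.2 (4.18)]
[cite: MadrasSlade1993, Cor. 5.3.2 (5.3.3) (reprint PDF p. 148)] -/
theorem toReal_tsum_sq_weighted_repBubble_le_sum_wbxOrderXQ {ι : Type*} [Fintype ι] [Nonempty ι]
    (hd : 3 ≤ d) {p : unitInterval} (hp : p ∈ Set.Ioo (nbwThresholdI d) (criticalProbI d)) (m M : ℕ)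
    {J : ℕ → ℕ} (hJ : ∀ i ∈ Icc m M, i ≤ 2 * J i) {𝒮 : ι → ℕ × ℕ × Set (Site d)} {cμ : ℝ} {c : ι → ℝ}
    (hc : ∀ k, 0 < c k) {γ : Fin 3 → ℚ} (hΓ : ∀ i, nobleFOf 𝒮 cμ c i p ≤ (γ i : ℝ)) {k : ι}
    (hk : 𝒮 k = (1, M + 1, {(0 : Site d)})) {z : ℚ} (hpz : (p : ℝ) ≤ (z : ℝ)) {I : ℕ → ℚ}
    (hI : ∀ i ∈ Icc m M, srwI d 1 (2 * J i) 0 ≤ (I i : ℝ)) :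
    (∑' y : Site d, ENNReal.ofReal (euclidNorm y ^ 2) *
        bondPercolation (zdGraph d) p (openConnGe m (0 : Site d) y □ openConn y 0)).toReal ≤
      (∑ i ∈ Icc m M, (z : ℝ) ^ i * (wbxOrderXQ d i (2 * J i) z (γ 1) (I i) : ℝ)) +
        (2 * d * (z : ℝ)) ^ (M + 1) * ((γ 2 : ℝ) * c k) := by
  have h := toReal_tsum_sq_weighted_repBubble_le_liveListAtomsCanon hd hp m M hc (Γ := fun i => (γ i : ℝ)) hΓ hk
    (fun i _ => 2 * J i) hpz (C := fun i l => (sawAtomX d (2 * J i) l i : ℝ))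
    (fun i hi l hl => cast_card_sawWordsTo_canonSite_le_sawAtomX (mem_liveList.1 hl).2.2.1 (hJ i hi))
    (b := fun i l r => (sawAtomX d (2 * J i) l r : ℝ))
    (fun i _ l hl r hr => cast_card_sawWordsTo_canonSite_le_sawAtomX (mem_liveList.1 hl).2.2.1 hr.le)
    (fun i _ l hl r hr => sawAtomX_nonneg (mem_liveList.1 hl).2.2.1 hr.le) (K := fun i _ => (I i : ℝ))
    (fun i hi l _ => (srwK_le_srwI_zero_of_even (n := 1) (by omega) (J i) (canonSite d l)).trans (hI i hi))
  refine h.trans (le_of_eq ?_)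
  congr 1
  refine sum_congr rfl fun i _ => ?_
  rw [cast_wbxOrderXQ]

/-- **Order-by-order kernel certificates at the overlay reading**: rationals `q i ≥ wbxOrderXQ d i (2J_i) z γ₁ I_i`
(`m ≤ i ≤ M`, each its own `decide +kernel`, chunked by `wbxOrderXQ_eq_take_add_drop` if needed) give
`Σ'_y ‖y‖₂² P_p(…) ≤ Σ_{i=m}^{M} z^i q_i + (2dz)^{M+1} γ₂ c_k`.
[cite: FitznerVanDerHofstad2016NoBLE, §5.3.1 (5.36)–(5.38) with §5.3.3 p. 1098; (5.14) p. 1092, (5.26) p. 1094]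
[cite: FitznerVanDerHofstad2017, §4.2 (4.18)] -/
theorem toReal_tsum_sq_weighted_repBubble_le_orderXBounds {ι : Type*} [Fintype ι] [Nonempty ι]
    (hd : 3 ≤ d) {p : unitInterval} (hp : p ∈ Set.Ioo (nbwThresholdI d) (criticalProbI d)) (m M : ℕ)
    {J : ℕ → ℕ} (hJ : ∀ i ∈ Icc m M, i ≤ 2 * J i) {𝒮 : ι → ℕ × ℕ × Set (Site d)} {cμ : ℝ} {c : ι → ℝ}
    (hc : ∀ k, 0 < c k) {γ : Fin 3 → ℚ} (hΓ : ∀ i, nobleFOf 𝒮 cμ c i p ≤ (γ i : ℝ)) {k : ι}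
    (hk : 𝒮 k = (1, M + 1, {(0 : Site d)})) {z : ℚ} (hpz : (p : ℝ) ≤ (z : ℝ)) {I : ℕ → ℚ}
    (hI : ∀ i ∈ Icc m M, srwI d 1 (2 * J i) 0 ≤ (I i : ℝ))
    {q : ℕ → ℚ} (hq : ∀ i ∈ Icc m M, wbxOrderXQ d i (2 * J i) z (γ 1) (I i) ≤ q i) :
    (∑' y : Site d, ENNReal.ofReal (euclidNorm y ^ 2) *
        bondPercolation (zdGraph d) p (openConnGe m (0 : Site d) y □ openConn y 0)).toReal ≤
      (∑ i ∈ Icc m M, (z : ℝ) ^ i * (q i : ℝ)) + (2 * d * (z : ℝ)) ^ (M + 1) * ((γ 2 : ℝ) * c k) := by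
  have hz : (0 : ℝ) ≤ z := le_trans (by exact_mod_cast unitInterval.nonneg p) hpz
  refine (toReal_tsum_sq_weighted_repBubble_le_sum_wbxOrderXQ hd hp m M hJ hc hΓ hk hpz hI).trans ?_
  gcongr with i hi
  exact hq i hi

/-- **The `WBX(M)` cell at the overlay reading with a CUT POLICY per class and FAR VALUES AT THE `K`-LEVEL**:
even cuts `2·J_i(l) ≥ i` and ANY rational majorants `F_i(l) ≥ K_{1,2J_i(l)}(x_l)` of the far node at the
canonical class points (e.g. the `x`-uniform cap `I_{1,2J}(0)` of (5.14) — the `hI` form below — or a `W`-split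
value, (5.9)/(5.16)).  Pointer language: an input-certification form, no statement about any dimension.
[cite: FitznerVanDerHofstad2016NoBLE, §5.3.1 (5.36)–(5.38) with §5.3.3 p. 1098; (5.9) p. 1091, (5.14) p. 1092]
[cite: FitznerVanDerHofstad2017, §4.2 (4.18)]
[cite: MadrasSlade1993, Cor. 5.3.2 (5.3.3) (reprint PDF p. 148)] -/
theorem toReal_tsum_sq_weighted_repBubble_le_sum_wbxOrderPolicyXQ_of_farValues {ι : Type*} [Fintype ι]
    [Nonempty ι] (hd : 3 ≤ d) {p : unitInterval} (hp : p ∈ Set.Ioo (nbwThresholdI d) (criticalProbI d))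
    (m M : ℕ) {J : ℕ → List ℕ → ℕ} (hJ : ∀ i ∈ Icc m M, ∀ l ∈ liveList d i, i ≤ 2 * J i l)
    {𝒮 : ι → ℕ × ℕ × Set (Site d)} {cμ : ℝ} {c : ι → ℝ} (hc : ∀ k, 0 < c k) {γ : Fin 3 → ℚ}
    (hΓ : ∀ i, nobleFOf 𝒮 cμ c i p ≤ (γ i : ℝ)) {k : ι} (hk : 𝒮 k = (1, M + 1, {(0 : Site d)}))
    {z : ℚ} (hpz : (p : ℝ) ≤ (z : ℝ)) {F : ℕ → List ℕ → ℚ}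
    (hF : ∀ i ∈ Icc m M, ∀ l ∈ liveList d i, srwK d 1 (2 * J i l) (canonSite d l) ≤ (F i l : ℝ)) :
    (∑' y : Site d, ENNReal.ofReal (euclidNorm y ^ 2) *
        bondPercolation (zdGraph d) p (openConnGe m (0 : Site d) y □ openConn y 0)).toReal ≤
      (∑ i ∈ Icc m M, (z : ℝ) ^ i * (wbxOrderPolicyXQ d i (J i) z (γ 1) (F i) : ℝ)) +
        (2 * d * (z : ℝ)) ^ (M + 1) * ((γ 2 : ℝ) * c k) := by
  have h := toReal_tsum_sq_weighted_repBubble_le_liveListAtomsCanon hd hp m M hc (Γ := fun i => (γ i : ℝ)) hΓ hk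
    (fun i l => 2 * J i l) hpz (C := fun i l => (sawAtomX d (2 * J i l) l i : ℝ))
    (fun i hi l hl => cast_card_sawWordsTo_canonSite_le_sawAtomX (mem_liveList.1 hl).2.2.1 (hJ i hi l hl))
    (b := fun i l r => (sawAtomX d (2 * J i l) l r : ℝ))
    (fun i _ l hl r hr => cast_card_sawWordsTo_canonSite_le_sawAtomX (mem_liveList.1 hl).2.2.1 hr.le)
    (fun i _ l hl r hr => sawAtomX_nonneg (mem_liveList.1 hl).2.2.1 hr.le) (K := fun i l => (F i l : ℝ)) hF
  refine h.trans (le_of_eq ?_)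
  congr 1
  refine sum_congr rfl fun i _ => ?_
  rw [cast_wbxOrderPolicyXQ]

/-- **Kernel certificates under a cut policy with far values at the `K`-level**: rationals
`q i ≥ wbxOrderPolicyXQ d i J_i z γ₁ F_i` give `Σ'_y ‖y‖₂² P_p(…) ≤ Σ_{i=m}^{M} z^i q_i + (2dz)^{M+1} γ₂ c_k`.
[cite: FitznerVanDerHofstad2016NoBLE, §5.3.1 (5.36)–(5.38) with §5.3.3 p. 1098; (5.9) p. 1091, (5.14) p. 1092]
[cite: FitznerVanDerHofstad2017, §4.2 (4.18)] -/
theorem toReal_tsum_sq_weighted_repBubble_le_policyXBounds_of_farValues {ι : Type*} [Fintype ι] [Nonempty ι]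
    (hd : 3 ≤ d) {p : unitInterval} (hp : p ∈ Set.Ioo (nbwThresholdI d) (criticalProbI d)) (m M : ℕ)
    {J : ℕ → List ℕ → ℕ} (hJ : ∀ i ∈ Icc m M, ∀ l ∈ liveList d i, i ≤ 2 * J i l)
    {𝒮 : ι → ℕ × ℕ × Set (Site d)} {cμ : ℝ} {c : ι → ℝ} (hc : ∀ k, 0 < c k) {γ : Fin 3 → ℚ}
    (hΓ : ∀ i, nobleFOf 𝒮 cμ c i p ≤ (γ i : ℝ)) {k : ι} (hk : 𝒮 k = (1, M + 1, {(0 : Site d)}))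
    {z : ℚ} (hpz : (p : ℝ) ≤ (z : ℝ)) {F : ℕ → List ℕ → ℚ}
    (hF : ∀ i ∈ Icc m M, ∀ l ∈ liveList d i, srwK d 1 (2 * J i l) (canonSite d l) ≤ (F i l : ℝ))
    {q : ℕ → ℚ} (hq : ∀ i ∈ Icc m M, wbxOrderPolicyXQ d i (J i) z (γ 1) (F i) ≤ q i) :
    (∑' y : Site d, ENNReal.ofReal (euclidNorm y ^ 2) *
        bondPercolation (zdGraph d) p (openConnGe m (0 : Site d) y □ openConn y 0)).toReal ≤
      (∑ i ∈ Icc m M, (z : ℝ) ^ i * (q i : ℝ)) + (2 * d * (z : ℝ)) ^ (M + 1) * ((γ 2 : ℝ) * c k) := by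
  have hz : (0 : ℝ) ≤ z := le_trans (by exact_mod_cast unitInterval.nonneg p) hpz
  refine (toReal_tsum_sq_weighted_repBubble_le_sum_wbxOrderPolicyXQ_of_farValues hd hp m M hJ hc hΓ hk hpz
    hF).trans ?_
  gcongr with i hi
  exact hq i hi

/-- **The `WBX(M)` cell at the overlay reading with a CUT POLICY per class** (even cuts `2·J_i(l) ≥ i`, rationals
`I_i(l) ≥ I_{1,2J_i(l)}(0; d)`) — the binders of `WbxCellKernel.toReal_tsum_sq_weighted_repBubble_le_sum_wbxOrderPolicyQ`
(the far values at the `K`-level being the `x`-uniform cap (5.14), `SrwIntegralSupZero.srwK_le_srwI_zero_of_even`).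
[cite: FitznerVanDerHofstad2016NoBLE, §5.3.1 (5.36)–(5.38) with §5.3.3 p. 1098; (5.14) p. 1092, (5.26) p. 1094]
[cite: FitznerVanDerHofstad2017, §4.2 (4.18)]
[cite: MadrasSlade1993, Cor. 5.3.2 (5.3.3) (reprint PDF p. 148)] -/
theorem toReal_tsum_sq_weighted_repBubble_le_sum_wbxOrderPolicyXQ {ι : Type*} [Fintype ι] [Nonempty ι]
    (hd : 3 ≤ d) {p : unitInterval} (hp : p ∈ Set.Ioo (nbwThresholdI d) (criticalProbI d)) (m M : ℕ)
    {J : ℕ → List ℕ → ℕ} (hJ : ∀ i ∈ Icc m M, ∀ l ∈ liveList d i, i ≤ 2 * J i l)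
    {𝒮 : ι → ℕ × ℕ × Set (Site d)} {cμ : ℝ} {c : ι → ℝ} (hc : ∀ k, 0 < c k) {γ : Fin 3 → ℚ}
    (hΓ : ∀ i, nobleFOf 𝒮 cμ c i p ≤ (γ i : ℝ)) {k : ι} (hk : 𝒮 k = (1, M + 1, {(0 : Site d)}))
    {z : ℚ} (hpz : (p : ℝ) ≤ (z : ℝ)) {I : ℕ → List ℕ → ℚ}
    (hI : ∀ i ∈ Icc m M, ∀ l ∈ liveList d i, srwI d 1 (2 * J i l) 0 ≤ (I i l : ℝ)) :
    (∑' y : Site d, ENNReal.ofReal (euclidNorm y ^ 2) *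
        bondPercolation (zdGraph d) p (openConnGe m (0 : Site d) y □ openConn y 0)).toReal ≤
      (∑ i ∈ Icc m M, (z : ℝ) ^ i * (wbxOrderPolicyXQ d i (J i) z (γ 1) (I i) : ℝ)) +
        (2 * d * (z : ℝ)) ^ (M + 1) * ((γ 2 : ℝ) * c k) :=
  toReal_tsum_sq_weighted_repBubble_le_sum_wbxOrderPolicyXQ_of_farValues hd hp m M hJ hc hΓ hk hpz
    fun i hi l hl => (srwK_le_srwI_zero_of_even (n := 1) (by omega) (J i l) (canonSite d l)).trans (hI i hi l hl)

/-- **Order-by-order kernel certificates at the overlay reading under a cut policy**: rationals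
`q i ≥ wbxOrderPolicyXQ d i J_i z γ₁ I_i` give `Σ'_y ‖y‖₂² P_p(…) ≤ Σ_{i=m}^{M} z^i q_i + (2dz)^{M+1} γ₂ c_k`.
[cite: FitznerVanDerHofstad2016NoBLE, §5.3.1 (5.36)–(5.38) with §5.3.3 p. 1098; (5.14) p. 1092, (5.26) p. 1094]
[cite: FitznerVanDerHofstad2017, §4.2 (4.18)] -/
theorem toReal_tsum_sq_weighted_repBubble_le_policyXBounds {ι : Type*} [Fintype ι] [Nonempty ι]
    (hd : 3 ≤ d) {p : unitInterval} (hp : p ∈ Set.Ioo (nbwThresholdI d) (criticalProbI d)) (m M : ℕ)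
    {J : ℕ → List ℕ → ℕ} (hJ : ∀ i ∈ Icc m M, ∀ l ∈ liveList d i, i ≤ 2 * J i l)
    {𝒮 : ι → ℕ × ℕ × Set (Site d)} {cμ : ℝ} {c : ι → ℝ} (hc : ∀ k, 0 < c k) {γ : Fin 3 → ℚ}
    (hΓ : ∀ i, nobleFOf 𝒮 cμ c i p ≤ (γ i : ℝ)) {k : ι} (hk : 𝒮 k = (1, M + 1, {(0 : Site d)}))
    {z : ℚ} (hpz : (p : ℝ) ≤ (z : ℝ)) {I : ℕ → List ℕ → ℚ}
    (hI : ∀ i ∈ Icc m M, ∀ l ∈ liveList d i, srwI d 1 (2 * J i l) 0 ≤ (I i l : ℝ))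
    {q : ℕ → ℚ} (hq : ∀ i ∈ Icc m M, wbxOrderPolicyXQ d i (J i) z (γ 1) (I i) ≤ q i) :
    (∑' y : Site d, ENNReal.ofReal (euclidNorm y ^ 2) *
        bondPercolation (zdGraph d) p (openConnGe m (0 : Site d) y □ openConn y 0)).toReal ≤
      (∑ i ∈ Icc m M, (z : ℝ) ^ i * (q i : ℝ)) + (2 * d * (z : ℝ)) ^ (M + 1) * ((γ 2 : ℝ) * c k) := by
  have hz : (0 : ℝ) ≤ z := le_trans (by exact_mod_cast unitInterval.nonneg p) hpz
  refine (toReal_tsum_sq_weighted_repBubble_le_sum_wbxOrderPolicyXQ hd hp m M hJ hc hΓ hk hpz hI).trans ?_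
  gcongr with i hi
  exact hq i hi

/-! ### §3b. One-stop forms: an origin `I`-table of extent `Λ` as the only far-node input -/

/-- **Overlay cell, one cut per order, far values from an origin table** (`T l ≥ I_{1,l}(0;d)` for `l ≤ Λ`,
extended exactly to the cut by `SrwOriginTailKernel.srwIZeroExtQ`): what remains rational-decidable is `hJ` and
`hq`.  Pointer language: an input-certification form, no statement about any dimension.
[cite: FitznerVanDerHofstad2016NoBLE, §5.3.1 (5.36)–(5.38) with §5.3.3 p. 1098; (5.14) p. 1092; §5.1 (5.1) p. 1090]
[cite: FitznerVanDerHofstad2017, §4.2 (4.18)] -/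
theorem toReal_tsum_sq_weighted_repBubble_le_orderXBounds_of_originTable {ι : Type*} [Fintype ι] [Nonempty ι]
    (hd : 3 ≤ d) {p : unitInterval} (hp : p ∈ Set.Ioo (nbwThresholdI d) (criticalProbI d)) (m M : ℕ)
    {J : ℕ → ℕ} (hJ : ∀ i ∈ Icc m M, i ≤ 2 * J i) {𝒮 : ι → ℕ × ℕ × Set (Site d)} {cμ : ℝ} {c : ι → ℝ}
    (hc : ∀ k, 0 < c k) {γ : Fin 3 → ℚ} (hΓ : ∀ i, nobleFOf 𝒮 cμ c i p ≤ (γ i : ℝ)) {k : ι}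
    (hk : 𝒮 k = (1, M + 1, {(0 : Site d)})) {z : ℚ} (hpz : (p : ℝ) ≤ (z : ℝ)) {Λ : ℕ} {T : ℕ → ℚ}
    (hT : ∀ l ≤ Λ, srwI d 1 l 0 ≤ (T l : ℝ)) {q : ℕ → ℚ}
    (hq : ∀ i ∈ Icc m M, wbxOrderXQ d i (2 * J i) z (γ 1) (srwIZeroExtQ d Λ T (2 * J i)) ≤ q i) :
    (∑' y : Site d, ENNReal.ofReal (euclidNorm y ^ 2) *
        bondPercolation (zdGraph d) p (openConnGe m (0 : Site d) y □ openConn y 0)).toReal ≤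
      (∑ i ∈ Icc m M, (z : ℝ) ^ i * (q i : ℝ)) + (2 * d * (z : ℝ)) ^ (M + 1) * ((γ 2 : ℝ) * c k) :=
  toReal_tsum_sq_weighted_repBubble_le_orderXBounds hd hp m M hJ hc hΓ hk hpz
    (I := fun i => srwIZeroExtQ d Λ T (2 * J i)) (fun _ _ => srwI_one_zero_le_srwIZeroExtQ hd hT _) hq

/-- **Overlay cell with a cut policy per class, far values from an origin table of extent `Λ`**
(`I i l := srwIZeroExtQ d Λ T (2·J i l)`, any depth beyond the table): what remains rational-decidable is `hJ`
and `hq` (one `decide +kernel` per order, chunked by `wbxOrderPolicyXQ_eq_take_add_drop`).  Pointer language: an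
input-certification form, no statement about any dimension.
[cite: FitznerVanDerHofstad2016NoBLE, §5.3.1 (5.36)–(5.38) with §5.3.3 p. 1098; (5.14) p. 1092; §5.1 (5.1) p. 1090]
[cite: FitznerVanDerHofstad2017, §4.2 (4.18)] -/
theorem toReal_tsum_sq_weighted_repBubble_le_policyXBounds_of_originTable {ι : Type*} [Fintype ι] [Nonempty ι]
    (hd : 3 ≤ d) {p : unitInterval} (hp : p ∈ Set.Ioo (nbwThresholdI d) (criticalProbI d)) (m M : ℕ)
    {J : ℕ → List ℕ → ℕ} (hJ : ∀ i ∈ Icc m M, ∀ l ∈ liveList d i, i ≤ 2 * J i l)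
    {𝒮 : ι → ℕ × ℕ × Set (Site d)} {cμ : ℝ} {c : ι → ℝ} (hc : ∀ k, 0 < c k) {γ : Fin 3 → ℚ}
    (hΓ : ∀ i, nobleFOf 𝒮 cμ c i p ≤ (γ i : ℝ)) {k : ι} (hk : 𝒮 k = (1, M + 1, {(0 : Site d)}))
    {z : ℚ} (hpz : (p : ℝ) ≤ (z : ℝ)) {Λ : ℕ} {T : ℕ → ℚ} (hT : ∀ l ≤ Λ, srwI d 1 l 0 ≤ (T l : ℝ))
    {q : ℕ → ℚ}
    (hq : ∀ i ∈ Icc m M,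
      wbxOrderPolicyXQ d i (J i) z (γ 1) (fun l => srwIZeroExtQ d Λ T (2 * J i l)) ≤ q i) :
    (∑' y : Site d, ENNReal.ofReal (euclidNorm y ^ 2) *
        bondPercolation (zdGraph d) p (openConnGe m (0 : Site d) y □ openConn y 0)).toReal ≤
      (∑ i ∈ Icc m M, (z : ℝ) ^ i * (q i : ℝ)) + (2 * d * (z : ℝ)) ^ (M + 1) * ((γ 2 : ℝ) * c k) :=
  toReal_tsum_sq_weighted_repBubble_le_policyXBounds hd hp m M hJ hc hΓ hk hpz
    (I := fun i l => srwIZeroExtQ d Λ T (2 * J i l)) (fun _ _ _ _ => srwI_one_zero_le_srwIZeroExtQ hd hT _) hq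

/-! ### §4. Sanity evaluations (kernel; rational bookkeeping at toy data — not statements about percolation) -/

/-- The overlay atom at the axis neighbour (class `l = [1, 0, 0]`, `coordList 1 l = [1]`), `d = 5`, row of cut `6`:
at `r = 3` the exact count `c_3 = 2(d−1) = 8` equals the NBW count (no 4-cycle fits into `r − ‖x‖₁ < 4` steps);
at `r = 5` the registry value `c_5 = 216` is strictly below `b_5 = 352`; at `r = 16` (no entry) the atom IS the
NBW majorant. [folklore] -/
example : sawAtomX 5 6 [1, 0, 0] 3 = 8 := by decide +kernel
example : sawAtomX 5 6 [1, 0, 0] 3 = nbwAtomFast 5 6 [1, 0, 0] 3 := by decide +kernel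
example : sawAtomX 5 6 [1, 0, 0] 5 = 216 := by decide +kernel
example : nbwAtomFast 5 6 [1, 0, 0] 5 = 352 := by decide +kernel
example : sawAtomX 5 16 [1, 0, 0] 16 = nbwAtomFast 5 16 [1, 0, 0] 16 := by decide +kernel

/-- Toy orders, `d = 3`, `z = 1/7`: at order `4`, cut `6` every atom read (`r − ‖x‖₁ ≤ 3`) is below the first
NBW/SAW discrepancy, so the overlay evaluator EQUALS the all-NBW evaluator of `WbxCellKernel`; at order `6`,
cut `8` it is strictly smaller. [folklore] -/
example : wbxOrderXQ 3 4 6 (1 / 7) 1 (1 / 10) = wbxOrderQ 3 4 6 (1 / 7) 1 (1 / 10) := by decide +kernel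
example : wbxOrderXQ 3 6 8 (1 / 7) 1 (1 / 10) < wbxOrderQ 3 6 8 (1 / 7) 1 (1 / 10) := by decide +kernel

/-- Table-range size, `d = 10`, order `i = 6` (18 live classes, every outer atom certified), cut `L = 22`,
`z = 1/17`: decided by the kernel in seconds, strictly below the all-NBW value. [folklore] -/
example : wbxOrderXQ 10 6 22 (1 / 17) 1 (1 / 10) < wbxOrderQ 10 6 22 (1 / 17) 1 (1 / 10) := by decide +kernel

/-- A policy order with the overlay: `d = 3`, order `6`, per-class cuts and far-node rationals; and a chunk (the
first five classes of order `9` at `d = 10`, cut `22`). [folklore] -/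
example : 0 ≤ wbxOrderPolicyXQ 3 6 (fun l => 4 + l.length) (1 / 7) 1 (fun l => 1 / (10 + l.sum)) := by
  decide +kernel
example : wbxClassesXQ 10 9 22 (1 / 17) 1 (1 / 10) ((liveList 10 9).take 5) <
    wbxClassesQ 10 9 22 (1 / 17) 1 (1 / 10) ((liveList 10 9).take 5) := by decide +kernel

-- the one-stop form's premise shape at toy data (`d = 3`, order 6, every class cut at 2·5 = 10 beyond a toy
-- table `T l = l` of extent 4): decidable in the kernel. [folklore]
example : wbxOrderPolicyXQ 3 6 (fun _ => 5) (1 / 7) 1 (fun _ => srwIZeroExtQ 3 4 (fun l => (l : ℚ)) (2 * 5)) <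
    wbxOrderPolicyQ 3 6 (fun _ => 5) (1 / 7) 1 (fun _ => srwIZeroExtQ 3 4 (fun l => (l : ℚ)) (2 * 5)) := by
  decide +kernel

end Literature.Probability.FitznerVanDerHofstad2017
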